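import Literature.Combinatorics.Additive.TripleProductProperty
import Summits.MatrixMultiplication.MatrixMultiplication.Theorems.SnSubsetDichotomyThresholdSubsetTriplesPairFactorisation

/-!
# `SnSubsetDichotomy.ThresholdSubsetTriples`, line `interleaved-subsignature-ascent` — stub `stub_ownerPairNoThird`

Registered stub `stub_ownerPairNoThird` of crux `stmt-MatrixMultiplication-10882` (negative design rule of census
c3a): the two complementary OWNER chain classes `S_A = subsig (ownerSystem L)` and `S_B = subsig (ownerSystem Lᶜ)`
factorise `S_n` exactly (`stub_pairFactorisation`, landed in
`SnSubsetDichotomyThresholdSubsetTriplesPairFactorisation`), and both contain `1` (every level of an owner system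
carries its identity letter), so `Q(S_A) · Q(S_B) ⊇ S_A⁻¹ S_B = S_n`; hence a third class `U` completing them to a
triple with the triple product property has at most ONE element: for `u, u' ∈ U` write `(u u'⁻¹)⁻¹ = a⁻¹ b` and feed
`s = 1, s' = a, t = b, t' = 1` to the TPP relation.

Mathlib API used: `Finset.card_le_one`, `Finset.mul_mem_mul`, `inv_mul_cancel`; tree API: `stub_pairFactorisation`,
`ownerSystem_of_mem`, `ownerSystem_of_not_mem`, `mem_starPiece`, `subsigBelow_zero`, `subsigBelow_succ`.
-/

-- `Summit.<Summit>.<Problem>` is the tree's mandated summit-side namespace; for this single-conjunct summit the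
-- two components coincide, so the file silences `dupNamespace` (same as the vocabulary file it imports).
set_option linter.dupNamespace false
set_option autoImplicit false

namespace Summit.MatrixMultiplication.MatrixMultiplication.Theorems.ThresholdSubsetTriples

open scoped Pointwise
open Literature.Combinatorics.Additive

/-- Every level `k` of an owner system carries its identity letter `k ∈ ownerSystem L k`. -/
theorem self_mem_ownerSystem {n : ℕ} (L : Finset (Fin n)) (k : Fin n) : k ∈ ownerSystem L k := by
  by_cases hk : k ∈ L
  · rw [ownerSystem_of_mem hk, Finset.mem_filter]
    exact ⟨Finset.mem_univ _, le_rfl⟩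
  · rw [ownerSystem_of_not_mem hk]
    exact Finset.mem_singleton_self _

/-- If every level carries its identity letter (`k ∈ D k`), the identity permutation is a word of every lower
chain class `subsigBelow D m` (choose the identity letter `swap k k = 1` at each level). -/
theorem one_mem_subsigBelow {n : ℕ} (D : Fin n → Finset (Fin n)) (hD : ∀ k, k ∈ D k) :
    ∀ m : ℕ, (1 : Equiv.Perm (Fin n)) ∈ subsigBelow D m := by
  intro m
  induction m with
  | zero =>
    rw [subsigBelow_zero]
    exact Finset.mem_singleton_self _
  | succ m ih =>
    rw [subsigBelow_succ]
    by_cases h : m < n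
    · rw [dif_pos h]
      have h1 : (1 : Equiv.Perm (Fin n)) ∈ starPiece (D ⟨m, h⟩) ⟨m, h⟩ :=
        mem_starPiece.2 ⟨⟨m, h⟩, hD _, by rw [Equiv.swap_self]; rfl⟩
      simpa using Finset.mul_mem_mul h1 ih
    · rw [dif_neg h]
      simpa using Finset.mul_mem_mul (Finset.mem_singleton_self (1 : Equiv.Perm (Fin n))) ih

/-- The identity permutation lies in every owner chain class `subsig (ownerSystem L)`. -/
theorem one_mem_subsig_ownerSystem {n : ℕ} (L : Finset (Fin n)) :
    (1 : Equiv.Perm (Fin n)) ∈ subsig (ownerSystem L) :=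
  one_mem_subsigBelow _ (self_mem_ownerSystem L) n

/-- **Stub `stub_ownerPairNoThird` (negative design rule, census c3a).**  An exact chain pair — the complementary
owner classes `subsig (ownerSystem L)`, `subsig (ownerSystem Lᶜ)` — admits no third class with two elements: if
`(S_A, S_B, U)` has the triple product property then `|U| ≤ 1`.  Proof: for `u, u' ∈ U` factor
`(u u'⁻¹)⁻¹ = a⁻¹ b` (`stub_pairFactorisation`); then `1 · a⁻¹ · (b · 1⁻¹) · (u u'⁻¹) = 1` with `1, a ∈ S_A` and
`b, 1 ∈ S_B`, so the TPP forces `u = u'`. [folklore-type; proved here] -/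
theorem stub_ownerPairNoThird {n : ℕ} (L : Finset (Fin n)) (U : Finset (Equiv.Perm (Fin n))) (hT : TripleProductProperty (subsig (ownerSystem L)) (subsig (ownerSystem Lᶜ)) U) : U.card ≤ 1 := by
  rw [Finset.card_le_one]
  intro u hu u' hu'
  obtain ⟨p, ⟨ha, hb, hab⟩, -⟩ := stub_pairFactorisation L (u * u'⁻¹)⁻¹
  have key : (1 : Equiv.Perm (Fin n)) * p.1⁻¹ * (p.2 * 1⁻¹) * (u * u'⁻¹) = 1 := by
    rw [one_mul, inv_one, mul_one, hab, inv_mul_cancel]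
  exact (hT 1 (one_mem_subsig_ownerSystem L) p.1 ha p.2 hb 1 (one_mem_subsig_ownerSystem Lᶜ)
    u hu u' hu' key).2.2

end Summit.MatrixMultiplication.MatrixMultiplication.Theorems.ThresholdSubsetTriples
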